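import Summits.ABC.ABC.Theses.IsogenyGlueCongruence
import Literature.AlgebraicGeometry.Motives.AbelianVarietyProduct
import Literature.AlgebraicGeometry.Motives.AbelianVarietyIsogenyProofs
import Literature.AlgebraicGeometry.Motives.TateAbelianFiniteLatticeProofs
import Literature.NumberTheory.DiophantineGeometry.AVIsogenyTate
import Literature.NumberTheory.DiophantineGeometry.AVIsogenyTateRationalEquivProofs
import Literature.NumberTheory.DiophantineGeometry.AVIsogenyTateInjectiveProofs
import Literature.NumberTheory.DiophantineGeometry.AVKernelHopf
import HarnessLib

/-!
# Case B engine of the isotypic dichotomy (stub `stub_caseB`, line `Sketch`)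

Stub `stub_caseB` of line `Sketch` (isotypic–Minkowski reduction) of crux U
`Summit.ABC.ABC.Theses.IsogenyGlueCongruence.EllipticGluingPrimeBound` (stmt-ABC-13919).

Setting: `E/ℚ` an AV-model of the elliptic curve `W` (`e : E(ℚ̄) ≃+ W(ℚ̄)` equivariant), `ℓ` a
prime at which `(E, B)` is glued (`ℓ` divides every `E`-multiplier `α ≫ β = n • 𝟙 E` of `B`),
`E[ℓ]` irreducible (every non-zero `Γ_ℚ`-stable subgroup of `E[ℓ]` is all of `E[ℓ]`), and a
splitting `σ = (i, j) : B₁ ⊞ B₂ → B` (an isogeny, `i` a closed immersion).  **Case B**: some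
multiplier `m` of `(E, B₁)` (`α₀ ≫ β₀ = m • 𝟙 E`) is prime to `ℓ`.  Conclusion: an isogeny
`h : B₂ → A` (a quotient by a finite subgroup) and a `Γ_ℚ`-equivariant embedding `W[ℓ] ↪ A(ℚ̄)`.

Proof.  Step 1 (`caseB_step1`): with `φ = pr₁ ≫ β₀ : B₁ ⊞ B₂ → E`, `Δ = ker σ(ℚ̄)` and `a` the
exponent of `ℓ` in the `n = ℓᵃ n'` of a quasi-inverse `σ'` of `σ`, the subgroup `Δ ∩ P[ℓᵃ]` is
not killed by `φ` — otherwise `σ' ≫ φ` kills `B[ℓᵃ](ℚ̄)` (isogenies are onto on `ℚ̄`-points), so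
`σ' ≫ φ = ℓᵃ • χ`, `σ ≫ χ = n' • φ`, and `(α₀ ≫ inl ≫ σ) ≫ χ = n' m • 𝟙 E` is a multiplier of
`(E, B)` prime to `ℓ`.  Hence `V = φ(Δ ∩ P[ℓᵃ]) ∩ E[ℓ]` is a non-zero (`exists_pow_smul_ne_zero`)
`Γ_ℚ`-stable subgroup of `E[ℓ]`, so `V = E[ℓ]` by irreducibility.  Step 2 (`caseB_step2`): with
`T = Δ ∩ P[ℓᵃ]`, `H = T ∩ φ⁻¹ E[ℓ] ↠ E[ℓ] ≅ W[ℓ]`, `H₀ = T ∩ ker φ`, quotient `B₂` by the finite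
`Γ_ℚ`-stable `ℓ`-power subgroup `pr₂(H₀)` (`A = B₂ / pr₂(H₀)`, kernel on `ℚ̄`-points exactly
`pr₂(H₀)`) and lift `h ∘ pr₂ : H → A(ℚ̄)` along `H ↠ W[ℓ]`; it is injective because `pr₂` is
injective on `Δ` (`i` is a monomorphism on `ℚ̄`-points) and equivariant because `h, φ, e` are.

Tree inputs (all proved): `AbelianVariety.IsIsogeny.exists_nsmul_inverse_holds` (quasi-inverse),
`AbelianVariety.exists_eq_nsmul_of_forall_geomTorsion` (a hom killing `A[m](ℚ̄)` is divisible by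
`m`), `AbelianVariety.IsIsogeny.geomPointsMap_surjective`,
`AbelianVariety.exists_isogeny_kerPoints_le` (quotient by a finite stable `ℓ`-power subgroup),
`AbelianVariety.isIsogeny_zsmul_id_of_cast_ne_zero` and `IsIsogeny.cancel_left`,
`mem_geomTorsion_iff'`, `smul_mem_geomTorsion`, `Hom.geomPointsMap_{comp,add,id,smul}`,
`geomPointsMap_nsmul_apply`, `AddSubgroup.torsionBy.coe_smul`; Mathlib
`AddMonoidHom.liftOfSurjective`, `Nat.exists_eq_pow_mul_and_not_dvd`.  No cited facts.
-/

noncomputable section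

-- `Summit.<Summit>.<Problem>` is the mandated summit-side namespace (CONVENTIONS §2); for the
-- single-conjunct summit `ABC` the two coincide, so the duplicate `ABC.ABC` is deliberate.
set_option linter.dupNamespace false

namespace Summit.ABC.ABC.Theorems.IsotypicMinkowski

open CategoryTheory CategoryTheory.Limits AlgebraicGeometry
open Literature.AlgebraicGeometry.Motives
open Summit.ABC.ABC.Theses.IsogenyGlueCongruence

/-- An additive isomorphism `E(ℚ̄) ≃+ W(ℚ̄)` maps `E[n]` onto `W[n]`: `P ∈ E[n] ↔ e P ∈ W[n]`. -/
private theorem mem_geomTorsion_iff_map {W : WeierstrassCurve ℚ} {E : AbelianVariety.{0} ℚ}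
    (e : E.geomPoints ≃+ W.geomPoints) {n : ℤ} {P : E.geomPoints} :
    P ∈ E.geomTorsion n ↔ e P ∈ W.geomTorsion n := by
  rw [AbelianVariety.mem_geomTorsion_iff']
  constructor
  · intro h
    exact (Submodule.mem_torsionBy_iff n (e P)).2 (by rw [← map_zsmul, h, map_zero])
  · intro h
    have h' := (Submodule.mem_torsionBy_iff n (e P)).1 h
    rwa [← map_zsmul, e.map_eq_zero_iff] at h'

/-- A closed-immersion homomorphism is injective on geometric points (a closed immersion is a
monomorphism of schemes). -/
private theorem geomPointsMap_injective_of_isClosedImmersion {X Y : AbelianVariety.{0} ℚ}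
    (i : X ⟶ Y) [IsClosedImmersion (AbelianVariety.Hom.toSchemeHom i)] :
    Function.Injective (AbelianVariety.Hom.geomPointsMap i) := by
  haveI : Mono i.hom.hom.hom := (Over.forget _).mono_of_mono_map (by
    change Mono (AbelianVariety.Hom.toSchemeHom i); infer_instance)
  intro x y hxy
  apply Additive.toMul.injective
  have h := congrArg Additive.toMul hxy
  rw [AbelianVariety.Hom.geomPointsMap_apply, AbelianVariety.Hom.geomPointsMap_apply,
    AlgPoints.map_apply, AlgPoints.map_apply] at h
  exact (cancel_mono i.hom.hom.hom).1 h

/-- In an `ℓ`-power-torsion situation a non-zero element has a non-zero multiple killed by `ℓ`: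
if `v ≠ 0` and `ℓᵃ • v = 0` then some `w = ℓᵏ • v ≠ 0` has `ℓ • w = 0`. -/
private theorem exists_pow_smul_ne_zero {M : Type*} [AddCommGroup M] {ℓ a : ℕ} {v : M}
    (hv : v ≠ 0) (ha : (ℓ ^ a : ℤ) • v = 0) :
    ∃ k : ℕ, (ℓ ^ k : ℤ) • v ≠ 0 ∧ (ℓ : ℤ) • ((ℓ ^ k : ℤ) • v) = 0 := by
  classical
  have hex : ∃ k : ℕ, (ℓ ^ k : ℤ) • v = 0 := ⟨a, ha⟩
  have hk₀ : Nat.find hex ≠ 0 := by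
    intro h0
    have h := Nat.find_spec hex
    rw [h0, pow_zero, one_smul] at h
    exact hv h
  obtain ⟨k, hk⟩ := Nat.exists_eq_succ_of_ne_zero hk₀
  refine ⟨k, Nat.find_min hex (by rw [hk]; exact Nat.lt_succ_self k), ?_⟩
  have h := Nat.find_spec hex
  rw [hk, pow_succ', mul_smul] at h
  exact h

/-- **Case B, step 1 (the `ℓ`-part of `Δ = ker σ(ℚ̄)` is not killed by `φ = pr₁ ≫ β₀`).**  For the
exponent `a` of `ℓ` in the `n` of a quasi-inverse of `σ = (i, j)` there is `d ∈ Δ` with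
`ℓᵃ • d = 0` and `φ d ≠ 0`.  (Otherwise `ψ = σ' ≫ φ` kills `B[ℓᵃ](ℚ̄)`, so `ψ = ℓᵃ • χ`, whence
`σ ≫ χ = n' • φ` and `(α₀ ≫ inl ≫ σ) ≫ χ = n' m • 𝟙 E` with `ℓ ∤ n' m`.) -/
private theorem caseB_step1 {E B B₁ B₂ : AbelianVariety.{0} ℚ} {ℓ : ℕ} (hℓ : ℓ.Prime)
    (hall : ∀ (α : E ⟶ B) (β : B ⟶ E) (n : ℤ), α ≫ β = n • 𝟙 E → (ℓ : ℤ) ∣ n)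
    (i : B₁ ⟶ B) (j : B₂ ⟶ B) (hσ : AbelianVariety.IsIsogeny (biprod.desc i j))
    (α₀ : E ⟶ B₁) (β₀ : B₁ ⟶ E) (m : ℤ) (hm : α₀ ≫ β₀ = m • 𝟙 E) (hndvd : ¬ (ℓ : ℤ) ∣ m) :
    ∃ a : ℕ, ∃ d : (B₁ ⊞ B₂).geomPoints,
      AbelianVariety.Hom.geomPointsMap (biprod.desc i j) d = 0 ∧ (ℓ ^ a : ℤ) • d = 0 ∧
      AbelianVariety.Hom.geomPointsMap (biprod.fst ≫ β₀) d ≠ 0 := by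
  classical
  set σ := biprod.desc i j with hσdef
  set φ : B₁ ⊞ B₂ ⟶ E := biprod.fst ≫ β₀ with hφdef
  -- a quasi-inverse `σ'` of `σ`: `σ ≫ σ' = [n]`, `σ' ≫ σ = [n]`, and `n = ℓᵃ n'`, `ℓ ∤ n'`
  obtain ⟨σ', n, hn, hσσ', -⟩ := AbelianVariety.IsIsogeny.exists_nsmul_inverse_holds hσ
  obtain ⟨a, n', hn'ℓ, hnn'⟩ := Nat.exists_eq_pow_mul_and_not_dvd hn.ne' ℓ hℓ.ne_one
  refine ⟨a, ?_⟩
  by_contra hcon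
  push Not at hcon
  -- `ψ = σ' ≫ φ` kills `B[ℓᵃ](ℚ̄)`
  set ψ : B ⟶ E := σ' ≫ φ with hψdef
  have hℓa : ((ℓ ^ a : ℕ) : ℚ) ≠ 0 := by exact_mod_cast pow_ne_zero a hℓ.ne_zero
  have hkill : ∀ Pt ∈ B.geomTorsion ((ℓ ^ a : ℕ) : ℤ),
      AbelianVariety.Hom.geomPointsMap ψ Pt = 0 := by
    intro Pt hPt
    obtain ⟨Q, rfl⟩ := hσ.geomPointsMap_surjective Pt
    have hPt' : (ℓ ^ a : ℤ) • AbelianVariety.Hom.geomPointsMap σ Q = 0 := by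
      have h := (AbelianVariety.mem_geomTorsion_iff' _).1 hPt
      rwa [Nat.cast_pow] at h
    -- `d = n' ℓᵃ • Q` lies in `Δ ∩ P[ℓᵃ]`
    set d : (B₁ ⊞ B₂).geomPoints := (n' : ℤ) • ((ℓ ^ a : ℤ) • Q) with hd
    have hd₁ : AbelianVariety.Hom.geomPointsMap σ d = 0 := by
      rw [hd, map_zsmul, map_zsmul, hPt', smul_zero]
    have hnQ : (n : ℤ) • ((ℓ ^ a : ℤ) • Q) = 0 := by
      have h1 : AbelianVariety.Hom.geomPointsMap (σ ≫ σ') ((ℓ ^ a : ℤ) • Q) = 0 := by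
        rw [AbelianVariety.Hom.geomPointsMap_comp, AddMonoidHom.comp_apply, map_zsmul, hPt',
          map_zero]
      rwa [hσσ', AbelianVariety.geomPointsMap_nsmul_apply, AbelianVariety.Hom.geomPointsMap_id,
        AddMonoidHom.id_apply, ← natCast_zsmul] at h1
    have hd₂ : (ℓ ^ a : ℤ) • d = 0 := by
      have h3 : (ℓ ^ a : ℤ) * n' * ℓ ^ a = (n : ℤ) * ℓ ^ a := by rw [hnn']; push_cast; ring
      rw [smul_smul] at hnQ
      rw [hd, smul_smul, smul_smul, h3, hnQ]
    have hd₃ := hcon d hd₁ hd₂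
    -- `ψ (σ Q) = φ (n • Q) = φ d = 0`
    have h2 : AbelianVariety.Hom.geomPointsMap ψ (AbelianVariety.Hom.geomPointsMap σ Q) =
        AbelianVariety.Hom.geomPointsMap φ (AbelianVariety.Hom.geomPointsMap (σ ≫ σ') Q) := by
      rw [hψdef, AbelianVariety.Hom.geomPointsMap_comp, AbelianVariety.Hom.geomPointsMap_comp]
      rfl
    rw [h2, hσσ', AbelianVariety.geomPointsMap_nsmul_apply, AbelianVariety.Hom.geomPointsMap_id,
      AddMonoidHom.id_apply, ← natCast_zsmul, hnn']
    rw [hd] at hd₃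
    convert hd₃ using 2
    rw [smul_smul]; push_cast; ring
  -- hence `ψ = ℓᵃ • χ`, `σ ≫ χ = n' • φ`
  obtain ⟨χ, hχ⟩ := AbelianVariety.exists_eq_nsmul_of_forall_geomTorsion (ℓ ^ a) hℓa ψ hkill
  have hσχ : σ ≫ χ = (n' : ℤ) • φ := by
    have h1 : σ ≫ ψ = (n : ℤ) • φ := by
      rw [hψdef, ← Category.assoc, hσσ', Preadditive.nsmul_comp, Category.id_comp, natCast_zsmul]
    rw [hχ, Preadditive.comp_zsmul, hnn', Nat.cast_mul] at h1
    have h2 : (((ℓ ^ a : ℕ) : ℤ) • 𝟙 (B₁ ⊞ B₂)) ≫ (σ ≫ χ) =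
        (((ℓ ^ a : ℕ) : ℤ) • 𝟙 (B₁ ⊞ B₂)) ≫ ((n' : ℤ) • φ) := by
      rw [Preadditive.zsmul_comp, Preadditive.zsmul_comp, Category.id_comp, Category.id_comp,
        h1, smul_smul]
    exact (AbelianVariety.isIsogeny_zsmul_id_of_cast_ne_zero (A := B₁ ⊞ B₂) _
      (by exact_mod_cast hℓa)).cancel_left h2
  -- the multiplier `n' m` of `(E, B)`, prime to `ℓ`
  have hmult : (α₀ ≫ biprod.inl ≫ σ) ≫ χ = ((n' : ℤ) * m) • 𝟙 E := by
    rw [Category.assoc, Category.assoc, hσχ, Preadditive.comp_zsmul, Preadditive.comp_zsmul, hφdef,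
      biprod.inl_fst_assoc, hm, smul_smul]
  have hdvd := hall _ _ _ hmult
  have hℓ' : Prime (ℓ : ℤ) := Nat.prime_iff_prime_int.1 hℓ
  rcases hℓ'.dvd_or_dvd hdvd with h | h
  · exact hn'ℓ (Int.natCast_dvd_natCast.1 h)
  · exact hndvd h

/-- **Case B, step 2 (quotient of the complement and the equivariant embedding of `W[ℓ]`).**
For a `Γ_ℚ`-stable subgroup `T ⊆ Δ` killed by `ℓᵃ` with `E[ℓ] ⊆ φ(T)`: `H = T ∩ φ⁻¹(E[ℓ])`,
`H₀ = T ∩ ker φ`, `S = pr₂(H₀) ⊆ B₂(ℚ̄)`, `A = B₂ / S` (`exists_isogeny_kerPoints_le`), and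
`ι : W[ℓ] ≅ E[ℓ] ≅ H/H₀ ↪ A(ℚ̄)` is `AddMonoidHom.liftOfSurjective` of `h ∘ pr₂` along
`H ↠ W[ℓ]` (injective since `pr₂` is injective on `Δ`; equivariant since `h, φ, e` are). -/
private theorem caseB_step2 {W : WeierstrassCurve ℚ} {E B B₁ B₂ : AbelianVariety.{0} ℚ}
    (e : E.geomPoints ≃+ W.geomPoints)
    (he : ∀ (σ : Field.absoluteGaloisGroup ℚ) (P : E.geomPoints), e (σ • P) = σ • e P)
    {ℓ : ℕ} (hℓ : ℓ.Prime) (i : B₁ ⟶ B) (j : B₂ ⟶ B)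
    [IsClosedImmersion (AbelianVariety.Hom.toSchemeHom i)]
    (β₀ : B₁ ⟶ E) (a : ℕ) (T : AddSubgroup (B₁ ⊞ B₂).geomPoints)
    (hTΔ : T ≤ (AbelianVariety.Hom.geomPointsMap (biprod.desc i j)).ker)
    (hTtors : ∀ d ∈ T, (ℓ ^ a : ℤ) • d = 0)
    (hTstab : ∀ (σ : Field.absoluteGaloisGroup ℚ) (d : (B₁ ⊞ B₂).geomPoints), d ∈ T → σ • d ∈ T)
    (hV : E.geomTorsion ℓ ≤ T.map (AbelianVariety.Hom.geomPointsMap (biprod.fst ≫ β₀))) :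
    ∃ (A : AbelianVariety.{0} ℚ) (h : B₂ ⟶ A), AbelianVariety.IsIsogeny h ∧
      ∃ ι : W.geomTorsion ℓ →+ A.geomPoints, Function.Injective ι ∧
        ∀ (σ : Field.absoluteGaloisGroup ℚ) (P : W.geomTorsion ℓ), ι (σ • P) = σ • ι P := by
  classical
  set σ := biprod.desc i j with hσdef
  set φ : B₁ ⊞ B₂ ⟶ E := biprod.fst ≫ β₀ with hφdef
  set pr₂ := AbelianVariety.Hom.geomPointsMap (biprod.snd : B₁ ⊞ B₂ ⟶ B₂) with hpr₂
  -- `pr₂` is injective on `Δ = ker σ(ℚ̄)` (`i` is a monomorphism on `ℚ̄`-points)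
  have hinj : ∀ x : (B₁ ⊞ B₂).geomPoints, AbelianVariety.Hom.geomPointsMap σ x = 0 →
      pr₂ x = 0 → x = 0 := by
    intro x hxσ hx₂
    have htot : x = AbelianVariety.Hom.geomPointsMap (biprod.fst ≫ biprod.inl) x +
        AbelianVariety.Hom.geomPointsMap (biprod.snd ≫ biprod.inr) x := by
      rw [← AddMonoidHom.add_apply, ← AbelianVariety.Hom.geomPointsMap_add, biprod.total,
        AbelianVariety.Hom.geomPointsMap_id, AddMonoidHom.id_apply]
    have h2 :
        AbelianVariety.Hom.geomPointsMap (biprod.snd ≫ biprod.inr : B₁ ⊞ B₂ ⟶ B₁ ⊞ B₂) x = 0 := by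
      rw [AbelianVariety.Hom.geomPointsMap_comp, AddMonoidHom.comp_apply, ← hpr₂, hx₂, map_zero]
    rw [h2, add_zero] at htot
    have h1 : AbelianVariety.Hom.geomPointsMap i
        (AbelianVariety.Hom.geomPointsMap (biprod.fst : B₁ ⊞ B₂ ⟶ B₁) x) = 0 := by
      have e1 : (AbelianVariety.Hom.geomPointsMap i).comp
          (AbelianVariety.Hom.geomPointsMap (biprod.fst : B₁ ⊞ B₂ ⟶ B₁)) =
          (AbelianVariety.Hom.geomPointsMap σ).comp
            (AbelianVariety.Hom.geomPointsMap (biprod.fst ≫ biprod.inl : B₁ ⊞ B₂ ⟶ B₁ ⊞ B₂)) := by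
        rw [← AbelianVariety.Hom.geomPointsMap_comp, ← AbelianVariety.Hom.geomPointsMap_comp,
          Category.assoc, hσdef, biprod.inl_desc]
      have e2 := congrArg (fun F ↦ F x) e1
      simp only [AddMonoidHom.comp_apply] at e2
      rw [e2, ← htot, hxσ]
    have h1' : AbelianVariety.Hom.geomPointsMap (biprod.fst : B₁ ⊞ B₂ ⟶ B₁) x = 0 := by
      rw [← (AbelianVariety.Hom.geomPointsMap i).map_zero] at h1
      exact geomPointsMap_injective_of_isClosedImmersion i h1
    rw [htot, AbelianVariety.Hom.geomPointsMap_comp, AddMonoidHom.comp_apply, h1', map_zero]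
  -- `H = T ∩ φ⁻¹ E[ℓ]`, `H₀ = T ∩ ker φ`, `S = pr₂(H₀)`
  let H : AddSubgroup (B₁ ⊞ B₂).geomPoints :=
    T ⊓ (E.geomTorsion ℓ).comap (AbelianVariety.Hom.geomPointsMap φ)
  let H₀ : AddSubgroup (B₁ ⊞ B₂).geomPoints := T ⊓ (AbelianVariety.Hom.geomPointsMap φ).ker
  let S : AddSubgroup B₂.geomPoints := H₀.map pr₂
  have hℓQ : (ℓ : ℚ) ≠ 0 := by exact_mod_cast hℓ.ne_zero
  have hSstab : ∀ (τ : Field.absoluteGaloisGroup ℚ) (y : B₂.geomPoints), y ∈ S → τ • y ∈ S := by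
    intro τ y hy
    rw [AddSubgroup.mem_map] at hy ⊢
    obtain ⟨x, hx, rfl⟩ := hy
    rw [AddSubgroup.mem_inf] at hx
    refine ⟨τ • x, AddSubgroup.mem_inf.2 ⟨hTstab τ x hx.1, ?_⟩,
      AbelianVariety.Hom.geomPointsMap_smul _ τ x⟩
    rw [AddMonoidHom.mem_ker, AbelianVariety.Hom.geomPointsMap_smul, AddMonoidHom.mem_ker.1 hx.2,
      smul_zero]
  have hStors : ∀ y ∈ S, ℓ ^ a • y = 0 := by
    intro y hy
    rw [AddSubgroup.mem_map] at hy
    obtain ⟨x, hx, rfl⟩ := hy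
    rw [← natCast_zsmul, ← map_zsmul, Nat.cast_pow, hTtors x (AddSubgroup.mem_inf.1 hx).1, map_zero]
  obtain ⟨A, h, hh, hker, -⟩ := B₂.exists_isogeny_kerPoints_le ℓ hℓQ a S hSstab hStors
  refine ⟨A, h, hh, ?_⟩
  -- `f : H ↠ W[ℓ]`, `t ↦ e (φ t)`, and `g : H → A(ℚ̄)`, `t ↦ h (pr₂ t)`
  have hHφ : ∀ t : H, AbelianVariety.Hom.geomPointsMap φ t ∈ E.geomTorsion ℓ :=
    fun t ↦ (AddSubgroup.mem_inf.1 t.2).2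
  let f : H →+ W.geomTorsion ℓ :=
    { toFun := fun t ↦ ⟨e (AbelianVariety.Hom.geomPointsMap φ t),
        (mem_geomTorsion_iff_map e).1 (hHφ t)⟩
      map_zero' := by ext; simp
      map_add' := fun t t' ↦ by ext; simp }
  have hf : ∀ t : H, (f t : W.geomPoints) = e (AbelianVariety.Hom.geomPointsMap φ t) := fun t ↦ rfl
  have hfsurj : Function.Surjective f := by
    intro Q
    have hP : e.symm Q ∈ E.geomTorsion ℓ :=
      (mem_geomTorsion_iff_map e).2 (by rw [e.apply_symm_apply]; exact Q.2)
    obtain ⟨t, ht, htP⟩ := AddSubgroup.mem_map.1 (hV hP)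
    have htH : t ∈ H := AddSubgroup.mem_inf.2 ⟨ht, by rw [AddSubgroup.mem_comap, htP]; exact hP⟩
    refine ⟨⟨t, htH⟩, Subtype.ext ?_⟩
    rw [hf]
    change e (AbelianVariety.Hom.geomPointsMap φ t) = Q
    rw [htP, e.apply_symm_apply]
  let g : H →+ A.geomPoints :=
    (AbelianVariety.Hom.geomPointsMap h).comp (pr₂.comp H.subtype)
  have hg : ∀ t : H, g t = AbelianVariety.Hom.geomPointsMap h (pr₂ t) := fun t ↦ rfl
  have hfg : f.ker ≤ g.ker := by
    intro t ht
    rw [AddMonoidHom.mem_ker] at ht ⊢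
    have ht' : AbelianVariety.Hom.geomPointsMap φ t = 0 := by
      have := congrArg Subtype.val ht
      rw [hf] at this
      exact e.map_eq_zero_iff.1 this
    rw [hg, hker]
    exact AddSubgroup.mem_map.2 ⟨t, AddSubgroup.mem_inf.2 ⟨(AddSubgroup.mem_inf.1 t.2).1,
      AddMonoidHom.mem_ker.2 ht'⟩, rfl⟩
  let ι : W.geomTorsion ℓ →+ A.geomPoints := AddMonoidHom.liftOfSurjective f hfsurj ⟨g, hfg⟩
  have hι : ∀ t : H, ι (f t) = g t := fun t ↦
    AddMonoidHom.liftOfRightInverse_comp_apply f _ _ ⟨g, hfg⟩ t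
  refine ⟨ι, ?_, ?_⟩
  · -- injectivity
    intro Q Q' hQQ'
    obtain ⟨t, rfl⟩ := hfsurj Q
    obtain ⟨t', rfl⟩ := hfsurj Q'
    rw [← sub_eq_zero, ← map_sub, ← map_sub, hι, hg, hker, AddSubgroup.mem_map] at hQQ'
    obtain ⟨x₀, hx₀, hx₀t⟩ := hQQ'
    rw [← sub_eq_zero, ← map_sub]
    -- `(t - t') - x₀ ∈ Δ` with `pr₂ = 0`, hence `0`; so `φ (t - t') = φ x₀ = 0`
    have hmemT : ((t - t' : H) : (B₁ ⊞ B₂).geomPoints) ∈ T := (AddSubgroup.mem_inf.1 (t - t').2).1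
    have hx₀T : x₀ ∈ T := (AddSubgroup.mem_inf.1 hx₀).1
    have hzero : ((t - t' : H) : (B₁ ⊞ B₂).geomPoints) - x₀ = 0 := by
      refine hinj _ ?_ ?_
      · have h1 := AddMonoidHom.mem_ker.1 (hTΔ hmemT)
        have h2 := AddMonoidHom.mem_ker.1 (hTΔ hx₀T)
        rw [map_sub, h1, h2, sub_zero]
      · rw [map_sub, sub_eq_zero]
        exact hx₀t.symm
    have hφ0 : AbelianVariety.Hom.geomPointsMap φ ((t - t' : H) : (B₁ ⊞ B₂).geomPoints) = 0 := by
      rw [sub_eq_zero.1 hzero]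
      exact AddMonoidHom.mem_ker.1 (AddSubgroup.mem_inf.1 hx₀).2
    ext
    rw [hf, hφ0, map_zero]
    rfl
  · -- equivariance
    intro τ Q
    obtain ⟨t, rfl⟩ := hfsurj Q
    have htτ : τ • (t : (B₁ ⊞ B₂).geomPoints) ∈ H := by
      refine AddSubgroup.mem_inf.2 ⟨hTstab τ _ (AddSubgroup.mem_inf.1 t.2).1, ?_⟩
      rw [AddSubgroup.mem_comap, AbelianVariety.Hom.geomPointsMap_smul]
      exact AbelianVariety.smul_mem_geomTorsion τ (hHφ t)
    have hfτ : f ⟨_, htτ⟩ = τ • f t := by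
      ext
      rw [hf, Literature.NumberTheory.EllipticCurves.AddSubgroup.torsionBy.coe_smul, hf]
      change e (AbelianVariety.Hom.geomPointsMap φ (τ • (t : (B₁ ⊞ B₂).geomPoints))) = _
      rw [AbelianVariety.Hom.geomPointsMap_smul, he]
    rw [← hfτ, hι, hι, hg, hg]
    change AbelianVariety.Hom.geomPointsMap h (pr₂ (τ • (t : (B₁ ⊞ B₂).geomPoints))) = _
    rw [hpr₂, AbelianVariety.Hom.geomPointsMap_smul, AbelianVariety.Hom.geomPointsMap_smul]

/-- **Case B engine of the isotypic dichotomy** (stub `stub_caseB` of line `Sketch`): given a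
splitting `(i, j) : B₁ ⊞ B₂ → B` (an isogeny, `i` a closed immersion), a multiplier `m` of
`(E, B₁)` prime to `ℓ` while `ℓ` divides every `E`-multiplier of `B`, and irreducibility of
`E[ℓ]` (every non-zero `Γ_ℚ`-stable subgroup of `E[ℓ]` is everything), there is an isogeny
`h : B₂ → A` (a quotient by a finite subgroup) with `W[ℓ] ↪ A(ℚ̄)` `Γ_ℚ`-equivariantly.
Assembled from `caseB_step1` (`β₀` does not kill the `ℓ`-part `T = Δ ∩ P[ℓᵃ]` of
`Δ = ker (i, j)(ℚ̄)`), irreducibility (`φ(T) ⊇ E[ℓ]`, as `φ(T) ∩ E[ℓ]` is stable and non-zero by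
`exists_pow_smul_ne_zero`) and `caseB_step2` (quotient of `B₂` by `pr₂(T ∩ ker φ)`). -/
theorem stub_caseB {W : WeierstrassCurve ℚ} [W.IsElliptic] {E B B₁ B₂ : AbelianVariety.{0} ℚ}
    (e : E.geomPoints ≃+ W.geomPoints)
    (he : ∀ (σ : Field.absoluteGaloisGroup ℚ) (P : E.geomPoints), e (σ • P) = σ • e P)
    {ℓ : ℕ} (hℓ : ℓ.Prime)
    (hirr : ∀ V : AddSubgroup E.geomPoints, V ≤ E.geomTorsion ℓ →
      (∀ (σ : Field.absoluteGaloisGroup ℚ) (P : E.geomPoints), P ∈ V → σ • P ∈ V) → V ≠ ⊥ →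
      E.geomTorsion ℓ ≤ V)
    (hall : ∀ (α : E ⟶ B) (β : B ⟶ E) (n : ℤ), α ≫ β = n • 𝟙 E → (ℓ : ℤ) ∣ n)
    (i : B₁ ⟶ B) (j : B₂ ⟶ B) [IsClosedImmersion (AbelianVariety.Hom.toSchemeHom i)]
    (hσ : AbelianVariety.IsIsogeny (biprod.desc i j))
    (α₀ : E ⟶ B₁) (β₀ : B₁ ⟶ E) (m : ℤ) (hm : α₀ ≫ β₀ = m • 𝟙 E) (hndvd : ¬ (ℓ : ℤ) ∣ m) :
    ∃ (A : AbelianVariety.{0} ℚ) (h : B₂ ⟶ A), AbelianVariety.IsIsogeny h ∧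
      ∃ ι : W.geomTorsion ℓ →+ A.geomPoints, Function.Injective ι ∧
        ∀ (σ : Field.absoluteGaloisGroup ℚ) (P : W.geomTorsion ℓ), ι (σ • P) = σ • ι P := by
  classical
  obtain ⟨a, d, hdσ, hda, hdφ⟩ := caseB_step1 hℓ hall i j hσ α₀ β₀ m hm hndvd
  set σ := biprod.desc i j with hσdef
  set φ : B₁ ⊞ B₂ ⟶ E := biprod.fst ≫ β₀ with hφdef
  -- `T = Δ ∩ P[ℓᵃ]`, a finite `Γ_ℚ`-stable subgroup of `P(ℚ̄)`
  let T : AddSubgroup (B₁ ⊞ B₂).geomPoints :=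
    (AbelianVariety.Hom.geomPointsMap σ).ker ⊓ (B₁ ⊞ B₂).geomTorsion ((ℓ : ℤ) ^ a)
  have hTΔ : T ≤ (AbelianVariety.Hom.geomPointsMap σ).ker := inf_le_left
  have hTtors : ∀ x ∈ T, (ℓ ^ a : ℤ) • x = 0 := fun x hx ↦
    (AbelianVariety.mem_geomTorsion_iff' x).1 hx.2
  have hTstab : ∀ (τ : Field.absoluteGaloisGroup ℚ) (x : (B₁ ⊞ B₂).geomPoints),
      x ∈ T → τ • x ∈ T := by
    intro τ x hx
    rw [AddSubgroup.mem_inf] at hx ⊢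
    obtain ⟨hx₁, hx₂⟩ := hx
    refine ⟨?_, AbelianVariety.smul_mem_geomTorsion τ hx₂⟩
    rw [AddMonoidHom.mem_ker] at hx₁ ⊢
    rw [AbelianVariety.Hom.geomPointsMap_smul, hx₁, smul_zero]
  have hdT : d ∈ T := AddSubgroup.mem_inf.2
    ⟨AddMonoidHom.mem_ker.2 hdσ, (AbelianVariety.mem_geomTorsion_iff' d).2 hda⟩
  -- `V = φ(T) ∩ E[ℓ]` is `Γ_ℚ`-stable and non-zero, hence all of `E[ℓ]` (irreducibility)
  let V : AddSubgroup E.geomPoints :=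
    T.map (AbelianVariety.Hom.geomPointsMap φ) ⊓ E.geomTorsion ℓ
  have hVstab : ∀ (τ : Field.absoluteGaloisGroup ℚ) (v : E.geomPoints), v ∈ V → τ • v ∈ V := by
    intro τ v hv
    rw [AddSubgroup.mem_inf] at hv ⊢
    obtain ⟨hv₁, hv₂⟩ := hv
    rw [AddSubgroup.mem_map] at hv₁
    obtain ⟨x, hx, rfl⟩ := hv₁
    refine ⟨AddSubgroup.mem_map.2 ⟨τ • x, hTstab τ x hx, ?_⟩,
      AbelianVariety.smul_mem_geomTorsion τ hv₂⟩
    exact AbelianVariety.Hom.geomPointsMap_smul φ τ x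
  have hVne : V ≠ ⊥ := by
    have hva : (ℓ ^ a : ℤ) • AbelianVariety.Hom.geomPointsMap φ d = 0 := by
      rw [← map_zsmul, hda, map_zero]
    obtain ⟨k, hk, hkℓ⟩ := exists_pow_smul_ne_zero hdφ hva
    intro hbot
    apply hk
    have hmem : (ℓ ^ k : ℤ) • AbelianVariety.Hom.geomPointsMap φ d ∈ V := by
      refine AddSubgroup.mem_inf.2
        ⟨AddSubgroup.zsmul_mem _ (AddSubgroup.mem_map.2 ⟨d, hdT, rfl⟩) _, ?_⟩
      exact (AbelianVariety.mem_geomTorsion_iff' _).2 hkℓ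
    rwa [hbot, AddSubgroup.mem_bot] at hmem
  have hV : E.geomTorsion ℓ ≤ T.map (AbelianVariety.Hom.geomPointsMap φ) :=
    (hirr V inf_le_right hVstab hVne).trans inf_le_left
  exact caseB_step2 e he hℓ i j β₀ a T hTΔ hTtors hTstab hV

end Summit.ABC.ABC.Theorems.IsotypicMinkowski

end
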